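import Summits.Ventures.LatticeQCDFlow.Exactness.FlowSamplerGroupSymmetrisationKL
import Summits.Ventures.LatticeQCDFlow.Exactness.Phi4LatticeSymmetry
import HarnessLib

/-!
# Averaging a flow over the lattice symmetry group never increases either Kullback–Leibler divergence to `e^{−S}/Z` and never decreases the overlap; an equivariant flow is unchanged

HONEST FRAMING: exact (Metropolis-corrected) sampling algorithms for lattice gauge theory;
figures of merit are autocorrelation/cost numbers at stated couplings and volumes; no
continuum-physics claim.  (SCALAR calibration rung S0-A: not a gauge result.)

Venture `LatticeQCDFlow` (cell pub-lqcd), topic `Exactness`; FANOUT row 2 (`s0-phi4`, FLOW arm).  NEW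
WORK of the cell: the lattice instances of `FlowSamplerGroupSymmetrisationKL` (there: any finite family
of measure-preserving symmetries of the target on an s-finite space) for the signed site symmetries
`t_a = latticeSymm (ρ a) (ε a)` of lattice φ⁴ (`Phi4LatticeSymmetry`: `ρ : G →* Sym(Λ)` into the
automorphisms of the couplings `J`, `ε : G →* ℤˣ` the optional flip), and the bookkeeping remark that a
flow which is already `G`-invariant (an EQUIVARIANT architecture, Boyda et al. 2021 NAMED) is its own
average, so every comparison of the averaging files is then an equality.  The training loss of the
S0-A flows is the reverse KL `∫ q̃ log(q̃/e^{−S})` up to the constant `log Z`; the forward KL controls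
the importance-sampling estimators; the overlap `∫ min(e^{−S}, q̃)` is the accepted mass of the
independence sampler from equilibrium at unit weight ratio.  Nothing is cited as a fact.

## What is proved (`λ > 0` where integrability of `e^{−S}` is needed, real `J`, `ρ(a)` `J`-automorphisms)

* **`phi4LatticeAvg_reverseKL_le`** — `∫ q̄ log(q̄/e^{−S}) ≤ ∫ q̃ log(q̃/e^{−S})` (finite when the
  right side is);
* **`phi4LatticeAvg_forwardKL_le`** — `∫ e^{−S} log(e^{−S}/q̄) ≤ ∫ e^{−S} log(e^{−S}/q̃)`;
* **`phi4LatticeAvg_overlap_ge`** — `∫ min(e^{−S}, q̃) ≤ ∫ min(e^{−S}, q̄)`;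
* `phi4LatticeAvg_eq_self_of_invariant` — `q̃ ∘ t_a = q̃` for all `a` ⇒ `q̄ = q̃`.

NOT CLAIMED: any value of a KL or overlap for any network; that averaging lowers the loss STRICTLY;
cost accounting.
-/

namespace Summit.Ventures.LatticeQCDFlow.Exactness

open Real MeasureTheory Filter Finset Set Topology
open Summit.Ventures.LatticeQCDFlow.Scoring

section Lattice

variable {n : ℕ} {G : Type*} [Group G] [Fintype G]

/-- **AVERAGING NEVER INCREASES THE REVERSE KL (the training loss up to `log Z`)**:
`∫ q̃ log(q̃/e^{−S}) ∈ L¹ ⇒ ∫ q̄ log(q̄/e^{−S}) ≤ ∫ q̃ log(q̃/e^{−S})`. -/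
theorem phi4LatticeAvg_reverseKL_le {lam : ℝ} (hlam : 0 < lam)
    {J : Fin (n + 1) → Fin (n + 1) → ℝ} {ρ : G →* Equiv.Perm (Fin (n + 1))}
    (hJ : ∀ a x y, J (ρ a x) (ρ a y) = J x y) (ε : G →* ℤˣ) {q : (Fin (n + 1) → ℝ) → ℝ}
    (hq0 : ∀ φ, 0 < q φ) (hqm : Measurable q) (hqi : Integrable q)
    (hKL : Integrable (fun φ => q φ * Real.log (q φ / gibbsWeight J lam φ))) :
    Integrable (fun φ => (∑ a, q (latticeSymm (ρ a) (ε a) φ)) / Fintype.card G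
      * Real.log ((∑ a, q (latticeSymm (ρ a) (ε a) φ)) / Fintype.card G / gibbsWeight J lam φ)) ∧
    ∫ φ, (∑ a, q (latticeSymm (ρ a) (ε a) φ)) / Fintype.card G
        * Real.log ((∑ a, q (latticeSymm (ρ a) (ε a) φ)) / Fintype.card G / gibbsWeight J lam φ)
      ≤ ∫ φ, q φ * Real.log (q φ / gibbsWeight J lam φ) :=
  groupAvg_reverseKL_le (μ := volume) (t := fun a => latticeSymm (ρ a) (ε a))
    (fun a => measurePreserving_latticeSymm (ρ a) (ε a)) (fun φ => gibbsWeight_pos J lam φ)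
    (continuous_gibbsWeight J lam).measurable (integrable_gibbsWeight hlam J)
    (fun a φ => gibbsWeight_latticeSymm (hJ a) (ε a) lam φ) hq0 hqm hqi hKL

/-- **AVERAGING NEVER INCREASES THE FORWARD KL**:
`∫ e^{−S} log(e^{−S}/q̃) ∈ L¹ ⇒ ∫ e^{−S} log(e^{−S}/q̄) ≤ ∫ e^{−S} log(e^{−S}/q̃)`. -/
theorem phi4LatticeAvg_forwardKL_le {lam : ℝ} (hlam : 0 < lam)
    {J : Fin (n + 1) → Fin (n + 1) → ℝ} {ρ : G →* Equiv.Perm (Fin (n + 1))}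
    (hJ : ∀ a x y, J (ρ a x) (ρ a y) = J x y) (ε : G →* ℤˣ) {q : (Fin (n + 1) → ℝ) → ℝ}
    (hq0 : ∀ φ, 0 < q φ) (hqm : Measurable q) (hqi : Integrable q)
    (hKL : Integrable (fun φ => gibbsWeight J lam φ * Real.log (gibbsWeight J lam φ / q φ))) :
    Integrable (fun φ => gibbsWeight J lam φ
      * Real.log (gibbsWeight J lam φ / ((∑ a, q (latticeSymm (ρ a) (ε a) φ)) / Fintype.card G))) ∧
    ∫ φ, gibbsWeight J lam φ
        * Real.log (gibbsWeight J lam φ / ((∑ a, q (latticeSymm (ρ a) (ε a) φ)) / Fintype.card G))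
      ≤ ∫ φ, gibbsWeight J lam φ * Real.log (gibbsWeight J lam φ / q φ) :=
  groupAvg_forwardKL_le (μ := volume) (t := fun a => latticeSymm (ρ a) (ε a))
    (fun a => measurePreserving_latticeSymm (ρ a) (ε a)) (fun φ => gibbsWeight_pos J lam φ)
    (continuous_gibbsWeight J lam).measurable (integrable_gibbsWeight hlam J)
    (fun a φ => gibbsWeight_latticeSymm (hJ a) (ε a) lam φ) hq0 hqm hqi hKL

/-- **AVERAGING NEVER DECREASES THE OVERLAP** `∫ min(e^{−S}, q)`. -/
theorem phi4LatticeAvg_overlap_ge {J : Fin (n + 1) → Fin (n + 1) → ℝ}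
    {ρ : G →* Equiv.Perm (Fin (n + 1))} (hJ : ∀ a x y, J (ρ a x) (ρ a y) = J x y) (ε : G →* ℤˣ)
    (lam : ℝ) {q : (Fin (n + 1) → ℝ) → ℝ} (hq0 : ∀ φ, 0 < q φ) (hqm : Measurable q)
    (hqi : Integrable q) :
    ∫ φ, min (gibbsWeight J lam φ) (q φ)
      ≤ ∫ φ, min (gibbsWeight J lam φ) ((∑ a, q (latticeSymm (ρ a) (ε a) φ)) / Fintype.card G) :=
  groupAvg_overlap_ge (μ := volume) (t := fun a => latticeSymm (ρ a) (ε a))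
    (fun a => measurePreserving_latticeSymm (ρ a) (ε a)) (fun φ => gibbsWeight_pos J lam φ)
    (continuous_gibbsWeight J lam).measurable (fun a φ => gibbsWeight_latticeSymm (hJ a) (ε a) lam φ)
    hq0 hqm hqi

omit [Group G] in
/-- **AN EQUIVARIANT FLOW IS ITS OWN AVERAGE**: `q̃ (t_a φ) = q̃ φ` for all `a` ⇒ `q̄ = q̃` — then every
'never worse' of the averaging files is an equality and averaging costs nothing and gains nothing. -/
theorem phi4LatticeAvg_eq_self_of_invariant [Nonempty G] (ρ : G → Equiv.Perm (Fin (n + 1)))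
    (ε : G → ℤˣ) {q : (Fin (n + 1) → ℝ) → ℝ} (hinv : ∀ a φ, q (latticeSymm (ρ a) (ε a) φ) = q φ) :
    (fun φ => (∑ a, q (latticeSymm (ρ a) (ε a) φ)) / Fintype.card G) = q := by
  have hN : (0 : ℝ) < Fintype.card G := by exact_mod_cast Fintype.card_pos
  funext φ
  simp only [hinv, Finset.sum_const, Finset.card_univ, nsmul_eq_mul]
  field_simp

end Lattice

end Summit.Ventures.LatticeQCDFlow.Exactness
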